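import Summits.QuantumAdvantage.QuantumAdvantage.Theorems.ResponseDialGA

/-! # ResponseDialG — ResponseDial REV 1 delta part 3/6 (mechanical split for landing; content verbatim; scopes re-opened with their variables) -/

set_option linter.dupNamespace false
noncomputable section
open scoped Classical

namespace Summit.QuantumAdvantage.QuantumAdvantage.Theorems.ResponseDial
open Finset
open Literature.Computability.QuantumComplexity Literature.Computability.QuantumComplexity.RingHLF
open Literature.Computability.MetaComplexity Literature.Computability.MetaComplexity.Smolensky
open Summit.QuantumAdvantage.AdviceFreeQNC0
open Summit.QuantumAdvantage.QuantumAdvantage.Theorems.AnchorDial (outB dev cN orbF orbL orbL_cons fz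
  cN_orbF_cast oddZeros_orbF win_iff gCond_iff_cN card_filter_orbF orbF_false flip2 card_odd_ge loss_shape_mono)
open Summit.QuantumAdvantage.QuantumAdvantage.Theorems.AnchorDial.Core (ct sg)
open Summit.QuantumAdvantage.QuantumAdvantage.Theorems.HolonomyDial (gCond tPoly tPoly_apply tPoly_mem card_odd_le
  xorP xorP_mem xorP_apply_bool mono_singleton_apply indP indP_mem indP_apply)
open Summit.QuantumAdvantage.QuantumAdvantage.Theorems.StabilizerDial (apIdx apStrat apStrat_mem bitP bitP_apStrat
  pad rel_pad_iff outB_pad_zero pad_mem StabFew rowMask bitP_pad mem_dev_pad_apStrat_iff BlockRec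
  blockSelect_of_fewLocus goodBound_of_blockRec fibreIdentityAt_of_block oddSliceBound_holds eventually_polylog
  side_bounds)
open Summit.QuantumAdvantage.QuantumAdvantage.Theorems.LocusDial (Coverable FewLocus)
open Summit.QuantumAdvantage.QuantumAdvantage.Theorems.SparsityDial (real_loss_of_frac AntipodalLoss3 stabFew_mono_mr
  one_le_logpow)
open Summit.QuantumAdvantage.QuantumAdvantage.Theses.SparsityDial (DenseGenericLoss3)

section Counter
variable {N : ℕ}

/-- **THE COUNTER LAW, pointwise**: a conditioned odd base point has a losing orbit image under the half-counter
family. -/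
theorem counter_orbit_loses (hN : 40 ≤ N) (x : Fin N → Bool) (hx : OddZeros x) (hfix : FixC x) :
    ∃ ε : Fin 5 → Bool, ¬ Rel (orbF hcSite ε x) (outB (fun i : Fin N => hcStrat i) (orbF hcSite ε x)) := by
  have hN22 : 22 ≤ N := by omega
  have hb := hcSite_sep
  have hbN := hcSite_le (N := N) hN22
  have hx0 : ∀ i : Fin 5, x (oddSite hbN i) = false := by
    intro i
    refine hfix.1 _ ?_
    rw [oddSite_hcSite hbN i]
    have := i.isLt
    omega
  set z : Fin 5 → Bool := fun i => zpar x (hcSite i + 1) with hz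
  set L : ZMod 3 := (lodd : CubeFn (ZMod 3) N) x with hL
  -- the sign change between sites 1 and 2 (cells 7, 8, 9, 10 hold exactly one zero)
  have h7 : x ⟨7, by omega⟩ = false := hfix.1 _ (by simp)
  have h8 : x ⟨8, by omega⟩ = true := hfix.2 _ (by simp)
  have h9 : x ⟨9, by omega⟩ = true := hfix.2 _ (by simp)
  have h10 : x ⟨10, by omega⟩ = true := hfix.2 _ (by simp)
  have hz12 : z 1 ≠ z 2 := by
    have s8 : zpar x 8 = xor (zpar x 7) (!x ⟨7, by omega⟩) := zpar_succ x (k := 7) (by omega)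
    have s9 : zpar x 9 = xor (zpar x 8) (!x ⟨8, by omega⟩) := zpar_succ x (k := 8) (by omega)
    have s10 : zpar x 10 = xor (zpar x 9) (!x ⟨9, by omega⟩) := zpar_succ x (k := 9) (by omega)
    have s11 : zpar x 11 = xor (zpar x 10) (!x ⟨10, by omega⟩) := zpar_succ x (k := 10) (by omega)
    have e1 : hcSite 1 + 1 = 7 := by decide
    have e2 : hcSite 2 + 1 = 11 := by decide
    show zpar x (hcSite 1 + 1) ≠ zpar x (hcSite 2 + 1)
    rw [e1, e2, s11, s10, s9, s8, h7, h8, h9, h10]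
    cases zpar x 7 <;> decide
  obtain ⟨hodd, hc1, hc0, hc5⟩ := certOKC_lam z hz12 L
  by_contra hall
  push Not at hall
  set gk : Fin N → ℕ := fun k => (univ.filter fun i : Fin 5 => hcSite i + 1 ≤ k.val).card with hgk
  have hgk6 : ∀ k, gk k < 6 := fun k =>
    Nat.lt_succ_of_le (le_trans (card_le_univ _) (by simp))
  set c : Fin N → ZMod 3 := fun k => ((cN x k.val : ℕ) : ZMod 3) with hc
  -- the deviation structure along the orbit
  have hT : ∀ ε, qbit (orbF hcSite ε x) = decide (L + cnt3 ε = 0) := fun ε => qbit_orbF_hc hN22 ε x hx0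
  have hD1 : ∀ (ε : Fin 5 → Bool) (k : Fin N), (1 ≤ k.val ∧ k.val < N / 2) →
      (k ∈ dev (fun i : Fin N => hcStrat i) (orbF hcSite ε x) ↔ x (apIdx k) = true) := by
    intro ε k hk
    rw [mem_dev_hc_first _ k hk, orbF_apply hb ε x (apIdx k), if_neg]
    rintro ⟨i, -, hi⟩
    have hap : N / 2 ≤ (apIdx k).val := by
      show N / 2 ≤ (k.val + N / 2) % N
      rw [Nat.mod_eq_of_lt (by omega)]; omega
    have := i.isLt
    unfold hcSite at hi
    omega
  have hD2 : ∀ (ε : Fin 5 → Bool) (k : Fin N), ¬ (1 ≤ k.val ∧ k.val < N / 2) →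
      (k ∈ dev (fun i : Fin N => hcStrat i) (orbF hcSite ε x) ↔ decide (L + cnt3 ε = 0) = true) := by
    intro ε k hk
    rw [mem_dev_hcStrat_iff _ k hk, hT ε]
  -- the win parity at each orbit point, in two blocks
  have hW : ∀ ε : Fin 5 → Bool,
      (∑ k : Fin N, (if (1 ≤ k.val ∧ k.val < N / 2) ∧ x (apIdx k) = true ∧ c k + sF z ε (gk k) ≠ 2
          then (1 : ZMod 2) else 0)) +
        ∑ k : Fin N, (if ¬ (1 ≤ k.val ∧ k.val < N / 2) ∧ decide (L + cnt3 ε = 0) = true ∧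
            c k + sF z ε (gk k) ≠ 2 then (1 : ZMod 2) else 0) = 1 := by
    intro ε
    have ho : OddZeros (orbF hcSite ε x) := (oddZeros_orbF hbN ε x).2 hx
    have hwin := (win_iff (by omega) (fun i : Fin N => hcStrat i) _ ho).1 (hall ε)
    have hphase : ∀ k : Fin N, gCond (orbF hcSite ε x) k.val ↔ c k + sF z ε (gk k) ≠ 2 := by
      intro k
      rw [gCond_iff_cN, mod3_ne_two, cN_orbF_cast x hb hbN ε k.val (le_of_lt k.isLt), shift_eq hb]
    have hfilt : ((dev (fun i : Fin N => hcStrat i) (orbF hcSite ε x)).filter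
        fun k => gCond (orbF hcSite ε x) k.val) =
        univ.filter fun k => k ∈ dev (fun i : Fin N => hcStrat i) (orbF hcSite ε x) ∧
          c k + sF z ε (gk k) ≠ 2 := by
      ext k
      rw [mem_filter, mem_filter, hphase k]
      simp only [mem_univ, true_and]
    rw [hfilt] at hwin
    have h1 : (((univ.filter fun k => k ∈ dev (fun i : Fin N => hcStrat i) (orbF hcSite ε x) ∧
        c k + sF z ε (gk k) ≠ 2).card : ℕ) : ZMod 2) = 1 := castZ2_of_mod_eq_one hwin
    rw [natCast_card_filter] at h1
    refine Eq.trans ?_ h1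
    rw [← sum_add_distrib]
    refine sum_congr rfl fun k _ => ?_
    by_cases hk : 1 ≤ k.val ∧ k.val < N / 2
    · have hiff := hD1 ε k hk
      by_cases hφ : c k + sF z ε (gk k) = 2
      · simp [hφ]
      · by_cases hxa : x (apIdx k) = true
        · have hm : k ∈ dev (fun i : Fin N => hcStrat i) (orbF hcSite ε x) := hiff.2 hxa
          simp [hk, hφ, hxa, hm]
        · have hm : k ∉ dev (fun i : Fin N => hcStrat i) (orbF hcSite ε x) := fun h => hxa (hiff.1 h)
          simp [hk, hφ, hxa, hm]
    · have hiff := hD2 ε k hk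
      by_cases hφ : c k + sF z ε (gk k) = 2
      · simp [hφ]
      · by_cases ht : decide (L + cnt3 ε = 0) = true
        · have hm : k ∈ dev (fun i : Fin N => hcStrat i) (orbF hcSite ε x) := hiff.2 ht
          simp [hk, hφ, ht, hm]
        · have hm : k ∉ dev (fun i : Fin N => hcStrat i) (orbF hcSite ε x) := fun h => ht (hiff.1 h)
          simp [hk, hφ, ht, hm]
  -- sum the win parities over the certificate
  have hLsum : ((lamC z L).map fun j =>
      (∑ k : Fin N, (if (1 ≤ k.val ∧ k.val < N / 2) ∧ x (apIdx k) = true ∧ c k + sF z (εOf j) (gk k) ≠ 2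
          then (1 : ZMod 2) else 0)) +
        ∑ k : Fin N, (if ¬ (1 ≤ k.val ∧ k.val < N / 2) ∧ decide (L + cnt3 (εOf j) = 0) = true ∧
            c k + sF z (εOf j) (gk k) ≠ 2 then (1 : ZMod 2) else 0)).sum =
      ((lamC z L).map fun _ => (1 : ZMod 2)).sum := by
    congr 1
    exact List.map_congr_left fun j _ => hW (εOf j)
  have hR : ((lamC z L).map fun _ => (1 : ZMod 2)).sum = 1 := by
    rw [List.map_const', List.sum_replicate, nsmul_eq_mul, mul_one]
    exact castZ2_of_mod_eq_one hodd
  rw [hR, List.sum_map_add] at hLsum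
  -- block 1 (frozen first-half indicators): per position an even exclusion count over the certificate
  have hA : ((lamC z L).map fun j =>
      ∑ k : Fin N, (if (1 ≤ k.val ∧ k.val < N / 2) ∧ x (apIdx k) = true ∧ c k + sF z (εOf j) (gk k) ≠ 2
          then (1 : ZMod 2) else 0)).sum = 0 := by
    rw [list_sum_swap]
    refine sum_eq_zero fun k _ => ?_
    by_cases hD : (1 ≤ k.val ∧ k.val < N / 2) ∧ x (apIdx k) = true
    · have h0 : ((lamC z L).map fun j =>
          if decide (c k + sF z (εOf j) (gk k) ≠ 2) = true then (1 : ZMod 2) else 0).sum = 0 := by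
        rw [list_sum_ite]; exact castZ2_of_mod_eq_zero (hc1 ⟨gk k, hgk6 k⟩ (c k))
      refine Eq.trans ?_ h0
      congr 1
      refine List.map_congr_left fun j _ => ?_
      by_cases h : c k + sF z (εOf j) (gk k) = 2 <;> simp [h, hD.1, hD.2]
    · have : ∀ j ∈ lamC z L, (if (1 ≤ k.val ∧ k.val < N / 2) ∧ x (apIdx k) = true ∧
          c k + sF z (εOf j) (gk k) ≠ 2 then (1 : ZMod 2) else 0) = 0 :=
        fun j _ => if_neg (fun h => hD ⟨h.1, h.2.1⟩)
      rw [List.map_congr_left this]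
      simp
  -- block 2 (the counter block): positions `0` and `≥ N/2` sit in groups `0` and `5`
  have hB : ((lamC z L).map fun j =>
      ∑ k : Fin N, (if ¬ (1 ≤ k.val ∧ k.val < N / 2) ∧ decide (L + cnt3 (εOf j) = 0) = true ∧
          c k + sF z (εOf j) (gk k) ≠ 2 then (1 : ZMod 2) else 0)).sum = 0 := by
    rw [list_sum_swap]
    refine sum_eq_zero fun k _ => ?_
    by_cases hk : 1 ≤ k.val ∧ k.val < N / 2
    · have : ∀ j ∈ lamC z L, (if ¬ (1 ≤ k.val ∧ k.val < N / 2) ∧ decide (L + cnt3 (εOf j) = 0) = true ∧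
          c k + sF z (εOf j) (gk k) ≠ 2 then (1 : ZMod 2) else 0) = 0 :=
        fun j _ => if_neg (fun h => h.1 hk)
      rw [List.map_congr_left this]
      simp
    · have hg : gk k = 0 ∨ gk k = 5 := by
        rcases Nat.lt_or_ge k.val 1 with h0 | h1
        · left
          show (univ.filter fun i : Fin 5 => hcSite i + 1 ≤ k.val).card = 0
          rw [Finset.card_eq_zero, filter_eq_empty_iff]
          intro i _
          unfold hcSite; omega
        · right
          have hk2 : N / 2 ≤ k.val := by
            by_contra hlt
            exact hk ⟨h1, by omega⟩
          show (univ.filter fun i : Fin 5 => hcSite i + 1 ≤ k.val).card = 5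
          rw [filter_true_of_mem fun i _ => ?_, card_univ, Fintype.card_fin]
          have := i.isLt
          unfold hcSite; omega
      have h0 : ((lamC z L).map fun j =>
          if (tC L j && decide (c k + sF z (εOf j) (gk k) ≠ 2)) = true then (1 : ZMod 2) else 0).sum = 0 := by
        rw [list_sum_ite]
        rcases hg with hg | hg
        · rw [hg]; exact castZ2_of_mod_eq_zero (hc0 (c k))
        · rw [hg]; exact castZ2_of_mod_eq_zero (hc5 (c k))
      refine Eq.trans ?_ h0
      congr 1
      refine List.map_congr_left fun j _ => ?_
      show (if ¬ (1 ≤ k.val ∧ k.val < N / 2) ∧ decide (L + cnt3 (εOf j) = 0) = true ∧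
          c k + sF z (εOf j) (gk k) ≠ 2 then (1 : ZMod 2) else 0) =
        if (decide (L + cnt3 (εOf j) = 0) && decide (c k + sF z (εOf j) (gk k) ≠ 2)) = true then 1 else 0
      by_cases h : c k + sF z (εOf j) (gk k) = 2 <;> by_cases ht : L + cnt3 (εOf j) = 0 <;> simp [h, ht, hk]
  rw [hA, hB, add_zero] at hLsum
  exact zero_ne_one hLsum

/-- **THE COUNTER LAW (counting)**: conditioned odd base points are charged to odd losers, 32 to 1. -/
theorem counter_loss_count (hN : 40 ≤ N) :
    (univ.filter fun x : Fin N → Bool => OddZeros x ∧ FixC x).card ≤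
      32 * (univ.filter fun x : Fin N → Bool =>
        OddZeros x ∧ ¬ Rel x (outB (fun i : Fin N => hcStrat i) x)).card := by
  refine le_trans (card_le_card fun x hx => ?_)
    (card_exists_orbF_le hcSite (fun y : Fin N → Bool =>
      OddZeros y ∧ ¬ Rel y (outB (fun i : Fin N => hcStrat i) y)))
  rw [mem_filter] at hx ⊢
  obtain ⟨-, hodd, hfix⟩ := hx
  obtain ⟨ε, hε⟩ := counter_orbit_loses hN x hodd hfix
  exact ⟨mem_univ _, ε, (oddZeros_orbF (hcSite_le (by omega)) ε x).2 hodd, hε⟩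

/-! ### the conditioned base points are a `1/512` fraction of the odd class (parity-repaired projection) -/

/-- impose the cell conditions. -/
def fixJ (x : Fin N → Bool) : Fin N → Bool := fun j =>
  if j.val = 3 ∨ j.val = 7 ∨ j.val = 11 ∨ j.val = 15 ∨ j.val = 19 then false
  else if j.val = 8 ∨ j.val = 9 ∨ j.val = 10 then true else x j

/-- ResponseDialG helper `fixJ_fixC` (decomp-qadv land package; see the module docstring). -/
theorem fixJ_fixC (x : Fin N → Bool) : FixC (fixJ x) := by
  refine ⟨fun j hj => ?_, fun j hj => ?_⟩
  · unfold fixJ; rw [if_pos hj]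
  · unfold fixJ; rw [if_neg (by omega), if_pos hj]

/-- toggle cell `0` (repairs the zero-parity; cell `0` is unconditioned and unread by the certificates). -/
def tog0 (hN : 1 ≤ N) (y : Fin N → Bool) : Fin N → Bool := Function.update y ⟨0, hN⟩ (!y ⟨0, hN⟩)

/-- ResponseDialG helper `oddZeros_tog0` (decomp-qadv land package; see the module docstring). -/
theorem oddZeros_tog0 (hN : 1 ≤ N) (y : Fin N → Bool) : OddZeros (tog0 hN y) ↔ ¬ OddZeros y := by
  unfold OddZeros tog0
  set p : Fin N := ⟨0, hN⟩ with hp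
  cases hy : y p
  · have hset : (univ.filter fun b : Fin N => Function.update y p (!false) b = false) =
        (univ.filter fun b : Fin N => y b = false).erase p := by
      ext b
      rw [mem_erase, mem_filter, mem_filter]
      by_cases hb : b = p
      · subst hb
        simp [hy]
      · rw [Function.update_of_ne hb]
        simp [hb]
    rw [hset]
    have hmem : p ∈ (univ.filter fun b : Fin N => y b = false) := mem_filter.2 ⟨mem_univ _, hy⟩
    rw [card_erase_of_mem hmem]
    have hpos := card_pos.2 ⟨p, hmem⟩
    omega
  · have hset : (univ.filter fun b : Fin N => Function.update y p (!true) b = false) =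
        insert p (univ.filter fun b : Fin N => y b = false) := by
      ext b
      rw [mem_insert, mem_filter, mem_filter]
      by_cases hb : b = p
      · subst hb
        simp [hy]
      · rw [Function.update_of_ne hb]
        simp [hb]
    rw [hset]
    have hnm : p ∉ (univ.filter fun b : Fin N => y b = false) := by simp [hy]
    rw [card_insert_of_notMem hnm]
    omega

/-- the parity-repaired projection onto the conditioned base points. -/
def fixup (hN : 1 ≤ N) (x : Fin N → Bool) : Fin N → Bool :=
  if OddZeros (fixJ x) then fixJ x else tog0 hN (fixJ x)

/-- ResponseDialG helper `fixup_odd` (decomp-qadv land package; see the module docstring). -/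
theorem fixup_odd (hN : 1 ≤ N) (x : Fin N → Bool) : OddZeros (fixup hN x) := by
  unfold fixup
  split_ifs with h
  · exact h
  · exact (oddZeros_tog0 hN _).2 h

/-- ResponseDialG helper `fixup_fixC` (decomp-qadv land package; see the module docstring). -/
theorem fixup_fixC (hN : 1 ≤ N) (x : Fin N → Bool) : FixC (fixup hN x) := by
  unfold fixup
  split_ifs with h
  · exact fixJ_fixC x
  · obtain ⟨h1, h2⟩ := fixJ_fixC x
    refine ⟨fun j hj => ?_, fun j hj => ?_⟩
    · have hj0 : j ≠ ⟨0, hN⟩ := fun e => by rw [e] at hj; simp at hj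
      show Function.update (fixJ x) ⟨0, hN⟩ (!fixJ x ⟨0, hN⟩) j = false
      rw [Function.update_of_ne hj0]; exact h1 j hj
    · have hj0 : j ≠ ⟨0, hN⟩ := fun e => by rw [e] at hj; simp at hj
      show Function.update (fixJ x) ⟨0, hN⟩ (!fixJ x ⟨0, hN⟩) j = true
      rw [Function.update_of_ne hj0]; exact h2 j hj

/-- the projection changes only the nine cells `0, 3, 7, 8, 9, 10, 11, 15, 19`. -/
theorem fixup_agree (hN : 1 ≤ N) (x : Fin N → Bool) (j : Fin N)
    (hj : ¬ (j.val = 0 ∨ j.val = 3 ∨ j.val = 7 ∨ j.val = 8 ∨ j.val = 9 ∨ j.val = 10 ∨ j.val = 11 ∨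
      j.val = 15 ∨ j.val = 19)) : fixup hN x j = x j := by
  have hJ : fixJ x j = x j := by
    unfold fixJ; rw [if_neg (by omega), if_neg (by omega)]
  have hj0 : j ≠ ⟨0, hN⟩ := fun e => by rw [e] at hj; simp at hj
  unfold fixup
  split_ifs
  · exact hJ
  · show Function.update (fixJ x) ⟨0, hN⟩ (!fixJ x ⟨0, hN⟩) j = x j
    rw [Function.update_of_ne hj0]; exact hJ

/-- the nine touched cells. -/
def kIdx : Fin 9 → ℕ := ![0, 3, 7, 8, 9, 10, 11, 15, 19]

/-- ResponseDialG helper `kIdx_lt` (decomp-qadv land package; see the module docstring). -/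
theorem kIdx_lt (hN : 40 ≤ N) (t : Fin 9) : kIdx t < N := by
  fin_cases t <;> simp [kIdx] <;> omega

/-- each fibre of the projection has at most `512` points. -/
theorem fixup_fibre_le (hN : 40 ≤ N) (y : Fin N → Bool) (s : Finset (Fin N → Bool)) :
    (s.filter fun x => fixup (N := N) (by omega) x = y).card ≤ 512 := by
  have h := card_le_card_of_injOn (s := s.filter fun x => fixup (N := N) (by omega) x = y)
    (t := (univ : Finset (Fin 9 → Bool)))
    (fun x : Fin N → Bool => fun t : Fin 9 => x ⟨kIdx t, kIdx_lt hN t⟩) (fun _ _ => mem_univ _) ?_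
  · refine le_trans h ?_
    rw [card_univ]
    norm_num [Fintype.card_fun, Fintype.card_bool, Fintype.card_fin]
  · intro x hx x' hx' hxx'
    rw [Finset.mem_coe, mem_filter] at hx hx'
    funext j
    by_cases hj : j.val = 0 ∨ j.val = 3 ∨ j.val = 7 ∨ j.val = 8 ∨ j.val = 9 ∨ j.val = 10 ∨ j.val = 11 ∨
        j.val = 15 ∨ j.val = 19
    · have ht : ∃ t : Fin 9, kIdx t = j.val := by
        rcases hj with h | h | h | h | h | h | h | h | h
        · exact ⟨0, h.symm⟩
        · exact ⟨1, h.symm⟩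
        · exact ⟨2, h.symm⟩
        · exact ⟨3, h.symm⟩
        · exact ⟨4, h.symm⟩
        · exact ⟨5, h.symm⟩
        · exact ⟨6, h.symm⟩
        · exact ⟨7, h.symm⟩
        · exact ⟨8, h.symm⟩
      obtain ⟨t, ht⟩ := ht
      have h' : x ⟨kIdx t, kIdx_lt hN t⟩ = x' ⟨kIdx t, kIdx_lt hN t⟩ := congrFun hxx' t
      have hjt : (⟨kIdx t, kIdx_lt hN t⟩ : Fin N) = j := Fin.ext ht
      rw [hjt] at h'
      exact h'
    · rw [← fixup_agree (N := N) (by omega) x j hj, ← fixup_agree (N := N) (by omega) x' j hj, hx.2, hx'.2]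

/-- `#odd ≤ 512 · #{odd conditioned base points}`. -/
theorem odd_le_fixC (hN : 40 ≤ N) :
    (univ.filter fun x : Fin N → Bool => OddZeros x).card ≤
      512 * (univ.filter fun x : Fin N → Bool => OddZeros x ∧ FixC x).card := by
  refine card_le_mul_card_image_of_maps_to (f := fixup (N := N) (by omega)) (fun x _ => ?_) 512
    (fun y _ => fixup_fibre_le hN y _)
  exact mem_filter.2 ⟨mem_univ _, fixup_odd _ x, fixup_fixC _ x⟩

/-- **half-counter counting law**: `#odd ≤ 16384 · #{odd losers of the half-counter family}` for `n ≥ 40`. -/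
theorem halfCounter_loss_count (n : ℕ) (hn : 40 ≤ n) :
    (univ.filter fun x : Fin n → Bool => OddZeros x).card ≤
      16384 * (univ.filter fun x : Fin n → Bool =>
        OddZeros x ∧ ¬ Rel x (outB (fun i : Fin n => hcStrat i) x)).card :=
  calc (univ.filter fun x : Fin n → Bool => OddZeros x).card
      ≤ 512 * (univ.filter fun x : Fin n → Bool => OddZeros x ∧ FixC x).card := odd_le_fixC hn
    _ ≤ 512 * (32 * (univ.filter fun x : Fin n → Bool =>
        OddZeros x ∧ ¬ Rel x (outB (fun i : Fin n => hcStrat i) x)).card) :=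
        Nat.mul_le_mul_left _ (counter_loss_count hn)
    _ = _ := by ring

/-- **RUNG `HalfCounterLoss3` PROVED** (`C = 1`, `n₀ = 16384`): the certified-dense, nowhere-additive half-counter
family is not near-perfect. -/
theorem halfCounterLoss3 : HalfCounterLoss3 :=
  ⟨1, 16384, fun n hn => real_loss_of_frac (M := 16384) (by norm_num) hn (by omega)
    (fun i : Fin n => hcStrat i) (halfCounter_loss_count n (by omega))⟩

end Counter




end Summit.QuantumAdvantage.QuantumAdvantage.Theorems.ResponseDial
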